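import Summits.BirchSwinnertonDyer.BirchSwinnertonDyer.Theses.PrintX9
import Literature.NumberTheory.EllipticCurves.CastellaGrossiLeeSkinner2022.HowardDivisibilityAnyClassNumber
import Summits.BirchSwinnertonDyer.BirchSwinnertonDyer.Theorems.Rank1ResidualX9CMPartner
import Summits.BirchSwinnertonDyer.Rank1Residual.X9.LeafDischargeScalarImage
import Literature.NumberTheory.EllipticCurves.HeegnerNormPointExistenceProofs
import Literature.NumberTheory.EllipticCurves.LambdaAdicSelmerDataProofs
import Literature.NumberTheory.EllipticCurves.IwasawaSelmerDualProofs
import Literature.NumberTheory.EllipticCurves.SelmerCorankHolds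
import Literature.NumberTheory.EllipticCurves.BSDSelmerParityDokchitserProofs
import Literature.NumberTheory.EllipticCurves.BSDSelmerCMPConverseHeegnerFieldProofs
import Literature.NumberTheory.EllipticCurves.Rank1Residual.ClassX1KellerYinTypeA
import HarnessLib

/-!
# Line `torsion-depth-light-ofprint` (crux stmt-BirchSwinnertonDyer-25235
# `PrintX9.HowardContainmentLightFrameOfPrint`), stub s3 `stub_depthPos_localized` BY SIGNATURE:
# the STABILIZED localized containment `p^m · I(Λκ_∞)² ⊆ char_Λ(X_tors)` on every light X9 frame,
# from CGLS 2022 Thm. 4.1.3 (`hCGLS`) and the tower containment `K_k ⊂ K[p^d]` (`hTw`) BY NAME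

Cell `run/shared/lean/pub/bsd-print-x9/` (D-0154 row 9, seat `bsd-line-x9-p2`). THEOREMS ONLY
(no definition, no named fact, no `sorry`); nothing booked or closed; BSD is not proved by any of
this; «beyond-print theorem»: NO — s3 is PRINT modulo typing (the two print inputs are the route's
`closes` binders `PrintX9.CGLSHowardDivisibilityLocalized` = the ∀-body of
`CastellaGrossiLeeSkinner2022.thm413_rankOne_charIdeal_torsion_dvd_localized` at universe `0`, lit
g19 p596552, and `PrintX9.AnticyclotomicTowerInRingClassFields`, stmt-25236).

WHAT (the registered stub, skeleton
`run/shared/lean/pub/bsd-print-x9/plan/skeletons/25235-torsion-depth-light-ofprint/torsion-depth-light-ofprint.lean`,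
namespace `Summit.BirchSwinnertonDyer.BirchSwinnertonDyer.Cruxes.HowardContainmentLightFrameOfPrint.TorsionDepthLight`):
`Stmt.stub_depthPos_localized := PrintX9.CGLSHowardDivisibilityLocalized →
PrintX9.AnticyclotomicTowerInRingClassFields → Stmt.depthPos_stabilizedLocalized`. The `Stmt` head
constants are NOT re-declared here (the skeleton is not a tree module and will land as the crux file);
`X9.torsionDepthLight_stub_depthPos_localized` below concludes the definiens VERBATIM, so in the line
file the stub is ONE line: `theorem stub_depthPos_localized : Stmt.stub_depthPos_localized :=
X9.torsionDepthLight_stub_depthPos_localized` (definitional unfolding; pattern of ty3 p596622 for s1).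

HOW (what the card says the prover owes, item by item):
* §1 `X9.exists_stabilizedHeegnerData_of_tower` — a term `C : StabilizedHeegnerData N W K κ jbar` from the
  tower containment AT `(K, κ, jbar)` (`∀ k, ∃ d, Gal(K̄/K[p^d]) ≤ Gal(K̄/K_k)`): the shift
  `d k := Nat.find …` (`layer_le`, `d_min`); the torsion depth `δ := Nat.findGreatest` on the set
  `{k | K_k ⊆ K[1]}`, a down-set (layers are nested, `ZpExtension.layerSubgroup_antitone`) containing
  `0` (`layerSubgroup_zero`) and BOUNDED because `K_k ⊆ K[1]` forces `p^k = [Γ_K : Gal(K̄/K_k)]`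
  (`index_layerSubgroup`) to divide the finite index of `Gal(K̄/K[1])` (`finiteIndex_ringClassSubgroup`);
  the norm points `u_k`, `v_k` of conductors `p^{d(k)}`, `p^{d(k)-1}` (prime to `N` since `p ∤ N`) by the
  PROVED `exists_isHeegnerNormPoint_holds` (Howard §2.7/§3.3 ∘ Gross §3 ∘ Darmon Thm. 3.6).
* §2 `X9.thm413Hypotheses_of_lightFrame` — CGLS's standing hypotheses on a light X9 frame: `p ≠ 2`
  and ordinary from `ClassX9` (`p ≥ 5` good ordinary), `p ∤ d_K` from `p` split and odd
  (`Rank1Residual.not_dvd_discr_of_split`), (h1) `E(K)[p] = 0` from (irr) over the quadratic `K`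
  (`torsionBy_eq_bot_of_isImaginaryQuadratic_of_hasIrreducibleModPGaloisRep`); the rest are binders.
* §3 `X9.selmerCorank_eq_one_of_rank_one` — `corank_{ℤ_p} Sel_{p^∞}(E/K) = 1` from `rank E(K) = 1`
  and `Ш(E/K)[p^∞]` finite (PROVED `selmerCorank_eq_mordellWeilRank_add_holds`, Greenberg LNM 1716 §1,
  + `zpCorank_eq_zero_of_finite`).
* §4 the stub: `𝔖_p(K_∞)` and `X` by the tree's existence theorems
  (`LambdaAdicSelmerDataExists.nonempty_lambdaAdicSelmerData`, `nonempty_selmerDualData_holds`), `C` by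
  §1, then `CastellaGrossiLeeSkinner2022.span_pow_mul_sq_le_charIdeal_torsion_of_thm413`. CGLS 4.1.3
  needs neither `δ > 0` nor `p ∣ h_K`: the body is proved for ALL light frames (`…_allDepths`) and the
  registered binder `ringClassSubgroup K 1 jbar ≤ κ.layerSubgroup 1` is then discarded.

References: [CastellaGrossiLeeSkinner2022] Invent. Math. 227 (2022) Thm. 4.1.3, Cor. 3.4.2, Rem. 4.1.4,
proof of Thm. 4.1.1 (`d(k)`, arXiv:2008.02571 p. 22); [PerrinRiou1987BSMF] §1 (`K_∞ ⊂ K[p^∞]`), §3.1;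
[Cox2013] Thm. 11.1; [Howard2004HeegnerKolyvagin] §2.7, §3.3; [GreenbergLNM1716] §1;
[GrossLMS1991] §2.
-/

set_option autoImplicit false

noncomputable section

open scoped Classical

open WeierstrassCurve NumberField Literature.NumberTheory.EllipticCurves
  Literature.NumberTheory.EllipticCurves.ModularForms
  Literature.NumberTheory.EllipticCurves.Rank1Residual
  Literature.NumberTheory.EllipticCurves.CastellaGrossiLeeSkinner2022

namespace Summit.BirchSwinnertonDyer.Rank1Residual

namespace X9

/-! ### §1 A `d(k)`-shifted stabilised Heegner datum from the tower containment (CGLS 2022, §4.1) -/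

section Tower

variable {N : ℕ} [NeZero N] {W : WeierstrassCurve ℚ} [W.IsElliptic] {K : Type} [Field K]
  [NumberField K] {p : ℕ} [Fact p.Prime] {κ : ZpExtension K p} {jbar : AlgebraicClosure K →+* ℂ}

/-- **Boundedness of the torsion layers**: if `K_k ⊆ K[1]` (`Gal(K̄/K[1]) ≤ Gal(K̄/K_k)`) then
`p^k = [Γ_K : Gal(K̄/K_k)]` divides the (finite, positive) index of `Gal(K̄/K[1])`, so
`k ≤ [Γ_K : Gal(K̄/K[1])]`. [cite: CastellaGrossiLeeSkinner2022, Thm. 4.1.1 proof (d(k) = 0 for finitely many k, arXiv:2008.02571 p. 22)]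
[cite: Cox2013, Thm. 11.1 (K[1] = K(j(𝒪_K)) is finite over K)] -/
theorem le_index_of_ringClassSubgroup_one_le {k : ℕ}
    (hk : ringClassSubgroup K 1 jbar ≤ κ.layerSubgroup k) :
    k ≤ (ringClassSubgroup K 1 jbar).index := by
  haveI := finiteIndex_ringClassSubgroup (K := K) 1 jbar
  have hdvd : (κ.layerSubgroup k).index ∣ (ringClassSubgroup K 1 jbar).index :=
    Subgroup.index_dvd_of_le hk
  rw [ZpExtension.index_layerSubgroup] at hdvd
  have hpos : 0 < (ringClassSubgroup K 1 jbar).index :=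
    Nat.pos_of_ne_zero Subgroup.FiniteIndex.index_ne_zero
  have hle : p ^ k ≤ (ringClassSubgroup K 1 jbar).index := Nat.le_of_dvd hpos hdvd
  exact le_trans (Nat.lt_pow_self (Fact.out : p.Prime).one_lt).le hle

/-- **The `d(k)`-shifted, `α`-stabilised Heegner datum of CGLS 2022 Thm. 4.1.1 / Rem. 4.1.4 EXISTS at
`(K, κ, jbar)` as soon as every layer `K_k` lies in some ring class field `K[p^d]`** (the classical
`K_∞^{ac} ⊂ K[p^∞]`, Perrin-Riou 1987 §1; the route's binder `AnticyclotomicTowerInRingClassFields`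
specialised to the frame), for `W/ℚ` elliptic with a parametrisation datum `Dt` at a level `N` prime
to `p`, `K` imaginary quadratic Heegner for `N` and an orientation `β` — WITH the given `Dt`, `β`, and
with torsion depth `δ > 0` iff `K_1 ⊆ K[1]` (the line's case split). Construction: the shift is
`d(k) = min {d : K_k ⊆ K[p^d]}` (`Nat.find`: `layer_le`, `d_min`); the torsion depth
`δ = max {k : K_k ⊆ K[1]}` (`Nat.findGreatest`; the set is a down-set — layers are nested,
`ZpExtension.layerSubgroup_antitone` — containing `0` — `layerSubgroup_zero` — and bounded by
`le_index_of_ringClassSubgroup_one_le`), whence `d(k) = 0 ↔ k ≤ δ`; the norm points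
`u_k = Norm_{K[p^{d(k)}]/K_k} P[p^{d(k)}]`, `v_k = Norm_{K_kK[p^{d(k)-1}]/K_k} P[p^{d(k)-1}]` at EVERY
layer by the proved `exists_isHeegnerNormPoint_holds` (conductors `p^{d(k)}`, `p^{d(k)-1}` are prime
to `N`; Howard §2.7/§3.3 ∘ Gross §3 ∘ Darmon Thm. 3.6).
[cite: CastellaGrossiLeeSkinner2022, Thm. 4.1.1 proof (d(k), P_k[n]) and Rem. 4.1.4 (arXiv:2008.02571 p. 22)]
[cite: PerrinRiou1987BSMF, §1 and §3.1] [cite: Howard2004HeegnerKolyvagin, §2.7 and §3.3] -/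
theorem exists_stabilizedHeegnerData_of_tower (hK : IsImaginaryQuadratic K)
    (hH : SatisfiesHeegnerHypothesis N K) (hpN : ¬ p ∣ N) (Dt : ModularParametrizationData W N)
    {β : ℤ} (hβ : (4 * N : ℤ) ∣ β ^ 2 - NumberField.discr K)
    (hTw : ∀ k : ℕ, ∃ d : ℕ, ringClassSubgroup K (p ^ d) jbar ≤ κ.layerSubgroup k) :
    ∃ C : StabilizedHeegnerData N W K κ jbar, C.Dt = Dt ∧ C.β = β ∧
      (0 < C.depth ↔ ringClassSubgroup K 1 jbar ≤ κ.layerSubgroup 1) := by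
  have hc : ∀ e : ℕ, (p ^ e).Coprime N := fun e ↦
    Nat.Coprime.pow_left _ ((Fact.out : p.Prime).coprime_iff_not_dvd.mpr hpN)
  have hex : ∀ (n e : ℕ), ∃ z, IsHeegnerNormPoint N W K κ Dt β jbar n (p ^ e) z := fun n e ↦
    exists_isHeegnerNormPoint_holds N W K p hK hH κ Dt hβ jbar n (hc e)
  choose u hu using fun k ↦ hex k (Nat.find (hTw k))
  choose v hv using fun k ↦ hex k (Nat.find (hTw k) - 1)
  -- the torsion depth: the largest `k ≤ [Γ_K : Gal(K̄/K[1])]` with `K_k ⊆ K[1]`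
  let P : ℕ → Prop := fun k ↦ ringClassSubgroup K 1 jbar ≤ κ.layerSubgroup k
  have hP0 : P 0 := by
    show ringClassSubgroup K 1 jbar ≤ κ.layerSubgroup 0
    rw [ZpExtension.layerSubgroup_zero]; exact le_top
  have hδ : P (Nat.findGreatest P (ringClassSubgroup K 1 jbar).index) :=
    Nat.findGreatest_spec (P := P) (Nat.zero_le _) hP0
  have hiff : ∀ k, P k ↔ k ≤ Nat.findGreatest P (ringClassSubgroup K 1 jbar).index := fun k ↦
    ⟨fun hk ↦ Nat.le_findGreatest (le_index_of_ringClassSubgroup_one_le hk) hk,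
      fun hk ↦ le_trans hδ (κ.layerSubgroup_antitone hk)⟩
  refine ⟨{ Dt := Dt
            β := β
            dvd_sq_sub := hβ
            d := fun k ↦ Nat.find (hTw k)
            layer_le := fun k ↦ Nat.find_spec (hTw k)
            d_min := fun k _ hd' ↦ Nat.find_min (hTw k) hd'
            depth := Nat.findGreatest P (ringClassSubgroup K 1 jbar).index
            d_eq_zero_iff := fun k ↦ by rw [Nat.find_eq_zero, pow_zero]; exact hiff k
            u := u
            isHeegnerNormPoint_u := fun k _ ↦ hu k
            v := v
            isHeegnerNormPoint_v := fun k _ ↦ hv k }, rfl, rfl, ?_⟩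
  show 0 < Nat.findGreatest P (ringClassSubgroup K 1 jbar).index ↔ P 1
  rw [hiff 1]
  omega

end Tower

/-! ### §2 CGLS 2022's standing hypotheses on a light X9 frame -/

section Frame

variable {W : WeierstrassCurve ℚ} [W.IsElliptic] [W.IsGloballyMinimal] {p : ℕ} [Fact p.Prime]
  {K : Type} [Field K] [NumberField K]

/-- **The hypotheses of CGLS 2022 Thm. 4.1.3 hold on every light X9 Heegner frame** — IN THE KERNEL:
`p ≠ 2` and good ordinary from `ClassX9` (`p ≥ 5`, `p ∤ a_p`), `p ∤ d_K` from `p` split in `K` and odd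
(`not_dvd_discr_of_split`), (h1) `E(K)[p] = 0` from (irr) over the quadratic field `K`
(`torsionBy_eq_bot_of_isImaginaryQuadratic_of_hasIrreducibleModPGaloisRep`); level `N = N_E` by `rfl`;
(Heeg), (disc), anticyclotomic `κ`, generator `γ` are the frame's binders. No class-number input.
[cite: CastellaGrossiLeeSkinner2022, §3.2 standing hypotheses + (h1), §4.1 (Heeg), (disc) (arXiv:2008.02571)]
[cite: GrossLMS1991, §2 (E(K)[p] = 0 from the image)] -/
theorem thm413Hypotheses_of_lightFrame
    (hX9 : Literature.NumberTheory.EllipticCurves.Rank1Residual.ClassX9 W p)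
    (hK : IsImaginaryQuadratic K) (hodd : Odd (NumberField.discr K)) (h3 : NumberField.discr K ≠ -3)
    (hHN : SatisfiesHeegnerHypothesis (W.conductorNorm ℤ) K) (hHp : SatisfiesHeegnerHypothesis p K)
    {κ : ZpExtension K p} (hκ : κ.IsAnticyclotomic) {γ : Field.absoluteGaloisGroup K}
    (hγ : κ.IsTopGenerator γ) :
    Thm413Hypotheses (W.conductorNorm ℤ) W K p κ γ where
  isElliptic := inferInstance
  level := rfl
  p_ne_two := hX9.ne_two
  ordinary := hX9.isOrdinaryAt
  isImaginaryQuadratic := hK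
  not_dvd_discr := not_dvd_discr_of_split hK Fact.out hX9.ne_two hHp
  noPTorsion := fun Q hQ ↦ by
    have hbot := torsionBy_eq_bot_of_isImaginaryQuadratic_of_hasIrreducibleModPGaloisRep W K hK
      (Fact.out : p.Prime) hX9.irr
    have hmem : Q ∈ AddSubgroup.torsionBy (W.baseChange K).toAffine.Point (p : ℤ) :=
      AddSubgroup.torsionBy.nsmul_iff.mpr hQ
    rw [hbot, AddSubgroup.mem_bot] at hmem
    exact hmem
  heegner := hHN
  discr_odd := hodd
  discr_ne := h3
  anticyclotomic := hκ
  topGenerator := hγ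

omit [W.IsGloballyMinimal] in
/-- **Selmer corank one on a rank-one frame with finite `Ш[p^∞]`**:
`corank_{ℤ_p} Sel_{p^∞}(E/K) = rank E(K) + corank_{ℤ_p} Ш(E/K)[p^∞] = 1 + 0`
(Greenberg LNM 1716 §1, PROVED in the tree as `selmerCorank_eq_mordellWeilRank_add_holds`; a finite
group has `ℤ_p`-corank `0`). [cite: GreenbergLNM1716, §1 (pp. 54–57)] -/
theorem selmerCorank_eq_one_of_rank_one (hrk : (W.baseChange K).mordellWeilRank = 1)
    (hfin : Finite (AddCommGroup.primaryComponent (W.baseChange K).sha p)) :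
    (W.baseChange K).selmerCorank p = 1 := by
  haveI := hfin
  have h0 : (W.baseChange K).shaCorank p = 0 := zpCorank_eq_zero_of_finite _ p
  rw [(W.baseChange K).selmerCorank_eq_mordellWeilRank_add_holds p, hrk, h0]

end Frame

/-! ### §3 The stabilized localized containment on EVERY light X9 frame (CGLS Thm. 4.1.3 by name) -/

/-- **CGLS 2022 Thm. 4.1.3 ("Moreover" clause = Cor. 3.4.2 for `κ^{Hg}`) gives, on every light X9
Heegner frame and for the GIVEN `jbar`, data `(𝔖_p(K_∞), C, X)` and `m` with
`(p^m) · I(Λκ_∞)² ⊆ char_Λ(X_tors)`** — for ALL torsion depths and ANY class number (the theorem has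
no such hypothesis), from the two print inputs BY NAME: `hCGLS` (the route binder
`PrintX9.CGLSHowardDivisibilityLocalized`, definitionally the fact
`CastellaGrossiLeeSkinner2022.thm413_rankOne_charIdeal_torsion_dvd_localized.{0}`) and `hTw`
(`PrintX9.AnticyclotomicTowerInRingClassFields`). Data: `𝔖_p(K_∞)` by
`LambdaAdicSelmerDataExists.nonempty_lambdaAdicSelmerData`, `X` by `nonempty_selmerDualData_holds`,
`C` by `exists_stabilizedHeegnerData_of_tower` (§1) on `(Dt, H.β)`; hypotheses by §2; corank one by
`selmerCorank_eq_one_of_rank_one`. PRINT modulo typing; «beyond-print theorem»: no.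
[cite: CastellaGrossiLeeSkinner2022, Thm. 4.1.3 with Cor. 3.4.2 and Rem. 4.1.4 (arXiv:2008.02571)]
[cite: PerrinRiou1987BSMF, §0 (p. 402) and §1] [cite: GreenbergLNM1716, §1] -/
theorem stabilizedLocalizedContainmentAt_of_thm413_of_tower
    (hCGLS : Summit.BirchSwinnertonDyer.BirchSwinnertonDyer.Theses.PrintX9.CGLSHowardDivisibilityLocalized)
    (hTw : Summit.BirchSwinnertonDyer.BirchSwinnertonDyer.Theses.PrintX9.AnticyclotomicTowerInRingClassFields)
    {W : WeierstrassCurve ℚ} [W.IsElliptic] [W.IsGloballyMinimal] {p : ℕ} [Fact p.Prime]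
    [NeZero (W.conductorNorm ℤ)] {K : Type} [Field K] [NumberField K]
    (hX9 : Literature.NumberTheory.EllipticCurves.Rank1Residual.ClassX9 W p)
    (hK : IsImaginaryQuadratic K) (hodd : Odd (NumberField.discr K)) (h3 : NumberField.discr K ≠ -3)
    (hHN : SatisfiesHeegnerHypothesis (W.conductorNorm ℤ) K) (hHp : SatisfiesHeegnerHypothesis p K)
    (κ : ZpExtension K p) (hκ : κ.IsAnticyclotomic)
    (γ : Field.absoluteGaloisGroup K) (hγ : κ.IsTopGenerator γ)
    (Dt : ModularParametrizationData W (W.conductorNorm ℤ))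
    (H : HeegnerDatum (W.conductorNorm ℤ) (NumberField.discr K))
    (jbar : AlgebraicClosure K →+* ℂ)
    (hrk : (W.baseChange K).mordellWeilRank = 1)
    (hfin : Finite (AddCommGroup.primaryComponent (W.baseChange K).sha p)) :
    ∃ (D : (W.baseChange K).LambdaAdicSelmerData κ γ)
      (C : StabilizedHeegnerData (W.conductorNorm ℤ) W K κ jbar)
      (X : (W.baseChange K).SelmerDualData κ γ) (m : ℕ),
      Ideal.span {((p : IwasawaAlgebra p) ^ m)} * stabilizedHeegnerCharIdeal D C ^ 2 ≤
        Module.charIdeal (IwasawaAlgebra p) (Submodule.torsion (IwasawaAlgebra p) X.X) := by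
  -- the data exist; `C` from the tower containment at the frame (p odd since p ≥ 5)
  have hp_odd : Odd p := (Fact.out : p.Prime).odd_of_ne_two hX9.ne_two
  obtain ⟨D⟩ := LambdaAdicSelmerDataExists.nonempty_lambdaAdicSelmerData (W.baseChange K) p κ hγ
  obtain ⟨X⟩ := (W.baseChange K).nonempty_selmerDualData_holds κ γ hγ
  obtain ⟨C, -, -, -⟩ := exists_stabilizedHeegnerData_of_tower (κ := κ) (jbar := jbar) hK hHN
    hX9.not_dvd_conductorNorm Dt H.dvd_sq_sub (fun k ↦ hTw K p hp_odd hK κ hκ jbar k)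
  -- CGLS Thm. 4.1.3 at the frame (the binder IS the fact at universe 0)
  have h413 : thm413_rankOne_charIdeal_torsion_dvd_localized.{0} := hCGLS
  obtain ⟨m, hm⟩ := span_pow_mul_sq_le_charIdeal_torsion_of_thm413 h413
    (thm413Hypotheses_of_lightFrame hX9 hK hodd h3 hHN hHp hκ hγ)
    (selmerCorank_eq_one_of_rank_one hrk hfin) D C X
  exact ⟨D, C, X, m, hm⟩

/-! ### §4 Stub s3 of line `torsion-depth-light-ofprint`, BY SIGNATURE -/

/-- **Stub `stub_depthPos_localized` of line `torsion-depth-light-ofprint` on crux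
`PrintX9.HowardContainmentLightFrameOfPrint` (stmt-BirchSwinnertonDyer-25235), BY SIGNATURE**: the type
is the definiens of the registered `Stmt.stub_depthPos_localized` VERBATIM —
`PrintX9.CGLSHowardDivisibilityLocalized → PrintX9.AnticyclotomicTowerInRingClassFields →` (the body
`Stmt.depthPos_stabilizedLocalized`: on a light X9 frame — `ClassX9 W p` in the items' letter, `K`
imaginary quadratic with `d_K` odd `≠ -3`, Heegner for `N_E` and `p`, (irr_K), anticyclotomic `(κ, γ)`,
data `Dt, H, ιC`, the GIVEN `jbar`, `rank E(K) = 1`, `Ш(E/K)[p^∞]` finite — at torsion depth `δ > 0`,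
`∃ D C X m, (p^m)·I(Λκ_∞)² ⊆ char_Λ(X_tors)`). The depth binder and (irr_K), `ιC` are not used
(§3 holds at every depth). PRINT modulo typing; «beyond-print theorem»: no.
[cite: CastellaGrossiLeeSkinner2022, Thm. 4.1.3 + Rem. 4.1.4 (arXiv:2008.02571, p. 22: d(k))] -/
theorem torsionDepthLight_stub_depthPos_localized :
    Summit.BirchSwinnertonDyer.BirchSwinnertonDyer.Theses.PrintX9.CGLSHowardDivisibilityLocalized →
    Summit.BirchSwinnertonDyer.BirchSwinnertonDyer.Theses.PrintX9.AnticyclotomicTowerInRingClassFields →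
    ∀ (W : WeierstrassCurve ℚ) [W.IsElliptic] [W.IsGloballyMinimal] (p : ℕ) [Fact p.Prime]
      [NeZero (W.conductorNorm ℤ)] (K : Type) [Field K] [NumberField K],
      Summit.BirchSwinnertonDyer.BirchSwinnertonDyer.Rank1Residual.ClassX9 W p →
      IsImaginaryQuadratic K → Odd (NumberField.discr K) → NumberField.discr K ≠ -3 →
      SatisfiesHeegnerHypothesis (W.conductorNorm ℤ) K → SatisfiesHeegnerHypothesis p K →
      (W.baseChange K).HasIrreducibleModPGaloisRep p →
      ∀ (κ : ZpExtension K p), κ.IsAnticyclotomic → ∀ (γ : Field.absoluteGaloisGroup K),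
      κ.IsTopGenerator γ →
      ∀ (Dt : ModularForms.ModularParametrizationData W (W.conductorNorm ℤ))
        (H : HeegnerDatum (W.conductorNorm ℤ) (NumberField.discr K)) (ιC : K →+* ℂ)
        (jbar : AlgebraicClosure K →+* ℂ),
      (W.baseChange K).mordellWeilRank = 1 →
      Finite (AddCommGroup.primaryComponent (W.baseChange K).sha p) →
      ringClassSubgroup K 1 jbar ≤ κ.layerSubgroup 1 →
      ∃ (D : (W.baseChange K).LambdaAdicSelmerData κ γ)
        (C : CastellaGrossiLeeSkinner2022.StabilizedHeegnerData (W.conductorNorm ℤ) W K κ jbar)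
        (X : (W.baseChange K).SelmerDualData κ γ) (m : ℕ),
        Ideal.span {((p : IwasawaAlgebra p) ^ m)} *
            CastellaGrossiLeeSkinner2022.stabilizedHeegnerCharIdeal D C ^ 2 ≤
          Module.charIdeal (IwasawaAlgebra p) (Submodule.torsion (IwasawaAlgebra p) X.X) := by
  intro hCGLS hTw W _ _ p _ _ K _ _ hX9 hK hodd h3 hHN hHp _ κ hκ γ hγ Dt H _ jbar hrk hfin _
  exact stabilizedLocalizedContainmentAt_of_thm413_of_tower hCGLS hTw
    (Summit.BirchSwinnertonDyer.BirchSwinnertonDyer.Rank1Residual.classX9_census_of_classX9 W p hX9)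
    hK hodd h3 hHN hHp κ hκ γ hγ Dt H jbar hrk hfin

end X9

end Summit.BirchSwinnertonDyer.Rank1Residual

end
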